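import Summits.BirchSwinnertonDyer.BirchSwinnertonDyer.Theorems.CongruentShaFreeCutTwoAdicControlOfPoitouTate
import Summits.BirchSwinnertonDyer.BirchSwinnertonDyer.Theorems.GoldfeldK12AdditiveTwoHeegner
import HarnessLib

set_option linter.dupNamespace false -- namespace `…BirchSwinnertonDyer.BirchSwinnertonDyer…` is the cell's (D-0017 nested layout)
set_option autoImplicit false

/-!
# Crux K12₂″ in the sibling cell's TWO-ADIC-LINKS currency — anticyclotomic control at the additive
# prime `2` (Link A) and main conjecture ∘ `2`-adic Waldspurger formula (Link B) over an auxiliary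
# Heegner field, for the additive `ℚ(√−7)`-twists; compositions PROVED, rank form of Link A PROVED
# modulo Poitou–Tate

Cell `bsd-goldfeld`, prover seat `s1p-c201` (gen 5), item stmt-BirchSwinnertonDyer-20044 (K12₂″,
`RankOneTwoConverseCMSevenAdditiveTwo`); TARGET v4 §2 c201 (b) = planner TRANSFER note
`ROUTE-S1PLUS/lines-g9/TRANSFER-CN100-LINKS.md` (L1)+(L2). Supports, does not close, the item. HONEST
FRAMING: nothing here proves K12₂″, BSD for any curve, or either link; two OPEN statements are NAMED
(`@[conjecture] def`, nothing asserted), their composition down to the crux BY NAME is PROVED, and the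
RANK form of the algebraic link is PROVED modulo the ONE textbook named fact
`poitouTate_sum_localTatePairing_eq_zero` (Milne ADT I Thm. 4.10(b); not a tree theorem today).

DICTIONARY (sibling cell `bsd-cn100`, rung S2, cruxes 19079/19080 ⟶ this cell, rung S1⁺). The
congruent-number curves `E_n` (CM by `ℤ[i]`, additive, potentially supersingular at `2`) and the curves
`W` of the additive cell of K12₂″ (CM by `ℤ[(1+√−7)/2]`, additive, potentially ORDINARY at `2`) sit in one
architecture: over an auxiliary imaginary quadratic `K` with the Heegner hypothesis for `N_W` and
`2 = v v̄` SPLIT, the leaf of K12₂″ one level down is `HeegnerNonTorsionCMSevenAdditiveTwo` (c201 file 5,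
p420647: `corank_{ℤ₂} Sel_{2^∞}(W/K) = 1 ⟹` Heegner points of level `N_W` are non-torsion) — the CORANK
analogue of cn100's `HeegnerNonTorsionAtTwo`. cn100 split that leaf over Castella's typed `Λ`-module
`𝔛 = AcSelmer.XAc (W_K) 2 κ v̄ ∅ γ` (dual Selmer over the anticyclotomic `ℤ₂`-tower, relaxed at `v`,
strict at `v̄` — local conditions blind to the reduction type, hence meaningful at an additive prime) into
Link A (CORANK form, the converse-theorem step: corank one ⟹ `𝔛` torsion with `F(0) ≠ 0`, currency
`∃ m, AcSelmer.XAc.HasCharValuationAt … m`) and Link B (corank one ⟹ `F(0) = u·log_ω(P_K)²`, `u ≠ 0`,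
for Heegner `P_K`: the Literature predicate `AcPConverseLinks.CharValueEqLogSqAt`, CGLS 2022 (5.4) ∘
Thm. 5.1.3 shape with the `2`-adic `L`-function eliminated), and PROVED links ⟹ non-torsion
(`AcPConverseLinks.not_isOfFinAddOrder_of_links`: generators of one principal ideal of `ℤ₂⟦T⟧` differ by
a unit; a torsion point has vanishing formal logarithm — AEC IV.6.4/VII.2.2, no height, no regulator) at
a datum that EXISTS (b2b CGLS adapter `X11b.exists_anticyclotomic_generator_degreeOnePrime`, `embAt`,
`inducedPlace`, `exists_other_prime`), plus the RANK form of Link A modulo Poitou–Tate by W- and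
p-GENERIC kernel theorems (`finite_selmerAcBase_of_rankOne_of_poitouTate`,
`hasCharValuationAt_of_finite_selmerAcBase`; bsd-cn100-plan g13 ACK 2026-08-26: cited by name, no rename
planned). This file instantiates all of it at `(W, 2)` for the additive `ℚ(√−7)`-cell:

* §1 (generic, PROVED; any globally minimal elliptic `W/ℚ`, any `p`, `K` imaginary quadratic, `p` split):
  `hasCharValuationAt_of_rankOne_of_poitouTate`, `…_of_corankOne_of_finiteSha_…`,
  `not_isOfFinAddOrder_of_charValueEqLogSqAt_of_rankOne_of_poitouTate`;
* §2 (OPEN, named): `TwoAdicControlOfCorankOneCMSeven`, `TwoAdicCharValueEqHeegnerLogSqCMSeven` — binders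
  of cn100's `TwoAdicControlOfCorankOne` / `TwoAdicCharValueEqHeegnerLogSq` with `E_n ↦ W`
  (`W.j = -3375`, `¬ W.HasGoodReductionAtPrime 2`);
* §3 (PROVED): links ⟹ the c201 leaf (NO Kato needed: the leaf is already in corank form over `K`) ⟹
  K12₂″ BY NAME through c201's landed chain (+ `2`-parity, Modularity, Hoffstein–Luo, GZK over `ℚ` or
  Kato at `2`, Gross–Zagier, Gross 1984);
* §4 (PROVED modulo Poitou–Tate): the RANK form of Link A for the cell;
* §5 (PROVED, the payoff): the Ш-FINITE SUB-CASE of K12₂″ from Link B ALONE — for `W` in the cell,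
  `rank W(ℚ) = 1 ∧ #Ш(W/ℚ)[2^∞] < ∞ ⟹ ord_{s=1} L(W,s) = 1`, granted `2`-parity, Modularity,
  Hoffstein–Luo, Kato, Gross–Zagier, Gross 1984, Poitou–Tate and the OPEN Link B (the shape of cn100's
  crux B `AnalyticRankOneOfRankOneFiniteShaTwo`, reached there modulo Link B + PT in four generations).

PLACEMENT (print): both links are theorems at good ordinary `p > 2` (CGLS 2022 Thm. 5.1.1, 5.1.3 +
(5.4); Skinner 2020; for CM curves Burungale–Tian 2020 / BCST 2022 via Rubin's two-variable main
conjecture), NOT at a prime of additive reduction; for this cell the nearest print is the CLAIM Fan–Wan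
arXiv:2304.09806v2 Thm. 1.1 §7 (unrefereed; planner file 16) and, on the half-cell where `7` splits in the
`2`-RAMIFIED twist field, the refereed ANALYTIC arrow Kriz 2021 Thm. 9.10 (c201 file
`GoldfeldK12AdditiveTwoRamifiedHeegner`; there `2` ramifies in `K`, here `2` splits). Versus the registered
skeleton v4 «wild-branches» (stubs by `ε ∈ {2, −1, −2}`): orthogonal cuts — each stub ⟸ (Link A-corank ∧
Link B) on its `ε`-class. PARTITION: none (RANK axis). BSD is not touched by any of this.

References: [CastellaGrossiLeeSkinner2022] Thm. 5.1.1, 5.1.3, (5.4), §5.2; [Castella2018] Def. 2.2,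
Thm. 2.3, 3.2; [JetchevSkinnerWan2017] Prop. 3.2.1, Thm. 3.3.1; [Skinner2020Converse] Thm. 1.1;
[BurungaleCastellaSkinnerTian2022] Thm. A, Rem. D; [MilneADT2006] I Thm. 4.10(b), 2.8; [GrossZagier1986]
Thm. I.6.3; [Gross1984] §§3–4; [Kato2004Asterisque] Cor. 14.3; [DokchitserDokchitserAnnals2010] Thm. 1.4;
[HoffsteinLuo1997] Thm. (§1); [SilvermanAEC2009] IV.6.4, VII.2.2; [FanWan2023] Thm. 1.1 (claim).
-/

noncomputable section

open scoped Classical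

namespace Summit.BirchSwinnertonDyer.BirchSwinnertonDyer.Theorems.GoldfeldGoodTwists

open WeierstrassCurve NumberField IsDedekindDomain Field Literature.NumberTheory.EllipticCurves
  Literature.NumberTheory.EllipticCurves.Castella2018
open Literature.NumberTheory.GaloisCohomology (poitouTate_sum_localTatePairing_eq_zero)
open Summit.BirchSwinnertonDyer.Rank1Residual
open Summit.BirchSwinnertonDyer.BirchSwinnertonDyer.Theorems.CongruentShaFreeCutTwoAdicControlOfPoitouTate
  (finite_selmerAcBase_of_rankOne_of_poitouTate)
open Summit.BirchSwinnertonDyer.BirchSwinnertonDyer.Theorems.CongruentShaFreeCutTwoAdicControlOfSelmerFinite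
  (hasCharValuationAt_of_finite_selmerAcBase)

/-! ## §1 Generic plumbing (PROVED): the rank-form control conclusion modulo Poitou–Tate -/

/-- **Rank-form anticyclotomic control, non-vanishing currency, modulo Poitou–Tate only.** For ANY
globally minimal elliptic `W/ℚ`, ANY prime `p`, `K` imaginary quadratic with `p` split, an anticyclotomic
`ℤ_p`-extension `κ` with topological generator `γ`, `𝔭 ∋ p`: `rank W(K) = 1 ∧ #Ш(W/K)[p^∞] < ∞ ⟹
∃ m, HasCharValuationAt (W_K) p κ 𝔭 ∅ γ m` (`𝔛` strict at `𝔭` is `Λ`-torsion, a characteristic generator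
does not vanish at `𝟙`). Composition of cn100's generic kernel theorems
`finite_selmerAcBase_of_rankOne_of_poitouTate` (JSW Prop. 3.2.1 bound; local Euler characteristic = tree
theorem) and `hasCharValuationAt_of_finite_selmerAcBase` (local kernels, control, Nakayama/Greenberg over
X11b). No ordinarity, no irreducibility, no `E(K_𝔭)[p] = 0`. CONDITIONAL on `hPT` at `K`.
[cite: JetchevSkinnerWan2017, Prop. 3.2.1 and §3.3 (shape of the proof)]
[cite: MilneADT2006, Ch. I, Thm. 4.10(b) (hypothesis kept) and Thm. 2.8 (discharged)]
[cite: GreenbergLNM1716, §3 Lemma 3.3, p. 90; §4 Lemma 4.2] -/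
theorem hasCharValuationAt_of_rankOne_of_poitouTate (W : WeierstrassCurve ℚ) [W.IsElliptic]
    [W.IsGloballyMinimal] (p : ℕ) [Fact p.Prime] {K : Type} [Field K] [NumberField K]
    (hPT : poitouTate_sum_localTatePairing_eq_zero K) (hK : IsImaginaryQuadratic K)
    (hsplit : X11b.SplitsIn K p) (κ : ZpExtension K p) (hκ : κ.IsAnticyclotomic)
    (γ : absoluteGaloisGroup K) [Fact (κ.IsTopGenerator γ)] (𝔭 : HeightOneSpectrum (𝓞 K))
    (h𝔭 : ((p : ℕ) : 𝓞 K) ∈ 𝔭.asIdeal) (hrank : (W.baseChange K).mordellWeilRank = 1)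
    (hSha : Finite (AddCommGroup.primaryComponent (W.baseChange K).sha p)) :
    ∃ m : ℕ, AcSelmer.XAc.HasCharValuationAt (W.baseChange K) p κ 𝔭 ∅ γ m := by
  haveI : Finite (X11b.AcSelmer.selmerAcBase (W.baseChange K) p 𝔭 ∅) :=
    finite_selmerAcBase_of_rankOne_of_poitouTate W p K hPT hK hsplit hrank hSha 𝔭 h𝔭
  exact hasCharValuationAt_of_finite_selmerAcBase W p hK hsplit κ hκ γ 𝔭 h𝔭

/-- **The same from corank one and finite Ш** (`corank = rank + corank Ш`, Greenberg's identity): the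
Ш-finite slice of a CORANK-form control statement is the rank form. CONDITIONAL on `hPT` at `K`.
[cite: Greenberg1999LNM, §1 pp. 54–57] [cite: MilneADT2006, Ch. I, Thm. 4.10(b) (hypothesis kept)] -/
theorem hasCharValuationAt_of_corankOne_of_finiteSha_of_poitouTate (W : WeierstrassCurve ℚ)
    [W.IsElliptic] [W.IsGloballyMinimal] (p : ℕ) [Fact p.Prime] {K : Type} [Field K] [NumberField K]
    (hPT : poitouTate_sum_localTatePairing_eq_zero K) (hK : IsImaginaryQuadratic K)
    (hsplit : X11b.SplitsIn K p) (κ : ZpExtension K p) (hκ : κ.IsAnticyclotomic)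
    (γ : absoluteGaloisGroup K) [Fact (κ.IsTopGenerator γ)] (𝔭 : HeightOneSpectrum (𝓞 K))
    (h𝔭 : ((p : ℕ) : 𝓞 K) ∈ 𝔭.asIdeal) (hcorank : (W.baseChange K).selmerCorank p = 1)
    (hSha : Finite (AddCommGroup.primaryComponent (W.baseChange K).sha p)) :
    ∃ m : ℕ, AcSelmer.XAc.HasCharValuationAt (W.baseChange K) p κ 𝔭 ∅ γ m := by
  haveI : (W.baseChange K).IsElliptic := by rw [baseChange]; infer_instance
  have h := (W.baseChange K).selmerCorank_eq_mordellWeilRank_add_holds p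
  have h0 : (W.baseChange K).shaCorank p = 0 :=
    (finite_primaryComponent_sha_iff_shaCorank_eq_zero (W.baseChange K) p).1 hSha
  have hrank : (W.baseChange K).mordellWeilRank = 1 := by omega
  exact hasCharValuationAt_of_rankOne_of_poitouTate W p hPT hK hsplit κ hκ γ 𝔭 h𝔭 hrank hSha

/-- **A point carrying Link B's identity at a rank-one datum is non-torsion, granted Poitou–Tate
only.** If `rank W(K) = 1`, `#Ш(W/K)[p^∞] < ∞` and some characteristic generator of `𝔛` (strict at
`𝔭`) has `F(0) = u · (log_W(z(m₀ • P_ι))/m₀)²`, `u ≠ 0` (`AcPConverseLinks.CharValueEqLogSqAt`), then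
`P` has infinite order: Link A (rank form) is `hasCharValuationAt_of_rankOne_of_poitouTate`, and two
generators of one principal ideal differ by a unit (`AcPConverseLinks.not_isOfFinAddOrder_of_links`).
[cite: CastellaGrossiLeeSkinner2022, §5.2 (proof of Thm. 5.2.1: the shape of a BDP-type p-converse)]
[cite: SilvermanAEC2009, IV.6.4 and VII.2.2] [cite: MilneADT2006, Ch. I, Thm. 4.10(b) (hypothesis kept)] -/
theorem not_isOfFinAddOrder_of_charValueEqLogSqAt_of_rankOne_of_poitouTate (W : WeierstrassCurve ℚ)
    [W.IsElliptic] [W.IsGloballyMinimal] (p : ℕ) [Fact p.Prime] {K : Type} [Field K] [NumberField K]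
    (hPT : poitouTate_sum_localTatePairing_eq_zero K) (hK : IsImaginaryQuadratic K)
    (hsplit : X11b.SplitsIn K p) (κ : ZpExtension K p) (hκ : κ.IsAnticyclotomic)
    (γ : absoluteGaloisGroup K) [Fact (κ.IsTopGenerator γ)] (𝔭 : HeightOneSpectrum (𝓞 K))
    (h𝔭 : ((p : ℕ) : 𝓞 K) ∈ 𝔭.asIdeal) (ι : K →+* ℚ_[p])
    (hrank : (W.baseChange K).mordellWeilRank = 1)
    (hSha : Finite (AddCommGroup.primaryComponent (W.baseChange K).sha p))
    (P : (W.baseChange K).toAffine.Point) (hB : AcPConverseLinks.CharValueEqLogSqAt W p κ 𝔭 γ ι P) :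
    ¬ IsOfFinAddOrder P :=
  AcPConverseLinks.not_isOfFinAddOrder_of_links W p κ 𝔭 γ ι P
    (hasCharValuationAt_of_rankOne_of_poitouTate W p hPT hK hsplit κ hκ γ 𝔭 h𝔭 hrank hSha) hB

/-! ## §2 The two links for the additive `ℚ(√−7)`-cell at `p = 2` (OPEN; named, nothing asserted) -/

/-- **Link A in CORANK currency for the additive `ℚ(√−7)`-cell — anticyclotomic control at the ADDITIVE
prime `2`, `p`-converse form.** For a globally minimal elliptic `W/ℚ` with `j(W) = −3375` NOT good at
`2`, an imaginary quadratic `K` with the Heegner hypothesis for `N = N_W` and `2 = v v̄` split, an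
embedding `ι : K ↪ ℚ₂` inducing `v`, the anticyclotomic `ℤ₂`-extension `κ` with topological generator
`γ`: `corank_{ℤ₂} Sel_{2^∞}(W/K) = 1 ⟹ 𝔛 = X_ac(W[2^∞])` (relaxed at `v`, strict at `v̄`) is `Λ`-torsion
and a characteristic generator has `F(0) ≠ 0` — `∃ m, AcSelmer.XAc.HasCharValuationAt … m`. Binders =
cn100's `TwoAdicControlOfCorankOne` with `E_n ↦ W`. The converse-theorem step (excludes corank carried by
Ш); its Ш-finite slice (RANK form) is PROVED below modulo Poitou–Tate. SHAPE of Skinner 2020 Thm. 1.1 /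
CGLS 2022 §5.2 / (CM, good ordinary, via Rubin's two-variable main conjecture over the CM field)
Burungale–Tian 2020, BCST 2022 §3 — for THIS cell that two-variable input is the `ℤ₂^×`-tower over
`ℚ(√−7)` of memo K12PP-RINGCLASS. OPEN at the additive prime `2` (nearest print: the CLAIM Fan–Wan v2
Thm. 1.1 §7). Research-grade; nothing asserted; strictly weaker than K12₂″ (no Heegner point, no `L`-value).
[cite: CastellaGrossiLeeSkinner2022, Thm. 5.1.1 and §5.2 (shape only; nothing asserted)]
[cite: Castella2018, Def. 2.2 and Thm. 2.3 (arXiv:1704.06608 p. 5) (shape only; nothing asserted)]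
[cite: BurungaleCastellaSkinnerTian2022, Thm. A and Rem. D (p. 327) (shape only; nothing asserted)] -/
@[conjecture] def TwoAdicControlOfCorankOneCMSeven : Prop :=
  ∀ (W : WeierstrassCurve ℚ) [W.IsElliptic] [W.IsGloballyMinimal], W.j = -3375 →
    ¬ W.HasGoodReductionAtPrime 2 →
    ∀ (K : Type) [Field K] [NumberField K] (N : ℕ) [NeZero N],
    W.conductorNorm ℤ = N → IsImaginaryQuadratic K →
      SatisfiesHeegnerHypothesis N K → SatisfiesHeegnerHypothesis 2 K →
    ∀ (ι : K →+* ℚ_[2]) (v vbar : HeightOneSpectrum (𝓞 K)),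
      (∀ x : 𝓞 K, x ∈ v.asIdeal ↔ ‖ι (x : K)‖ < 1) →
      ((2 : ℕ) : 𝓞 K) ∈ vbar.asIdeal → vbar ≠ v →
    ∀ (κ : ZpExtension K 2), κ.IsAnticyclotomic →
    ∀ (γ : absoluteGaloisGroup K) [Fact (κ.IsTopGenerator γ)],
      (W.baseChange K).selmerCorank 2 = 1 →
      ∃ m : ℕ, AcSelmer.XAc.HasCharValuationAt (W.baseChange K) 2 κ vbar ∅ γ m

/-- **Link B for the additive `ℚ(√−7)`-cell — the `2`-adic anticyclotomic main conjecture for `W` at the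
trivial character ∘ the `2`-adic Waldspurger/BDP formula: `F(0) = u · log_ω(P_K)²`, `u ≠ 0`.** For `W`,
`K`, `N = N_W`, `ι`, `v`, `v̄`, `κ`, `γ` as in Link A, under `corank_{ℤ₂} Sel_{2^∞}(W/K) = 1`, and for
every Heegner point `P ∈ W(K)` of level `N` (`IsHeegnerPoint`): some generator `F` of `char_Λ 𝔛` has
`F(0) = u · (log_W(z(m₀ • P_ι))/m₀)²`, `u ∈ ℚ₂`, `u ≠ 0` — the Literature predicate
`AcPConverseLinks.CharValueEqLogSqAt W 2 κ v̄ γ ι P`. Binders = cn100's `TwoAdicCharValueEqHeegnerLogSq`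
with `E_n ↦ W`. SHAPE of CGLS 2022 (5.4) ∘ Thm. 5.1.3, BDP 2013 Thm. 5.13, Castella 2018 Thm. 3.2; the
`2`-adic `L`-function of the printed proofs lives INSIDE this link (for the CM form of level `49·D²` the
BDP `p`-adic `L`-function over `K` factors through Katz-type `L`-functions over `K·ℚ(√−7)` — a second
road). OPEN at the additive prime `2`. Research-grade; nothing asserted; strictly weaker than K12₂″.
-- TODO(constant): at additive `2` no constant is in print, only `u ≠ 0`.
[cite: CastellaGrossiLeeSkinner2022, Thm. 4.2.2, Thm. 5.1.3 and display (5.4) (shape only; nothing asserted)]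
[cite: BertoliniDarmonPrasanna2013, Thm. 5.13 (shape only; nothing asserted)]
[cite: Castella2018, Thm. 3.2 (arXiv:1704.06608 p. 9) (shape only; nothing asserted)] -/
@[conjecture] def TwoAdicCharValueEqHeegnerLogSqCMSeven : Prop :=
  ∀ (W : WeierstrassCurve ℚ) [W.IsElliptic] [W.IsGloballyMinimal], W.j = -3375 →
    ¬ W.HasGoodReductionAtPrime 2 →
    ∀ (K : Type) [Field K] [NumberField K] (N : ℕ) [NeZero N],
    W.conductorNorm ℤ = N → IsImaginaryQuadratic K →
      SatisfiesHeegnerHypothesis N K → SatisfiesHeegnerHypothesis 2 K →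
    ∀ (ι : K →+* ℚ_[2]) (v vbar : HeightOneSpectrum (𝓞 K)),
      (∀ x : 𝓞 K, x ∈ v.asIdeal ↔ ‖ι (x : K)‖ < 1) →
      ((2 : ℕ) : 𝓞 K) ∈ vbar.asIdeal → vbar ≠ v →
    ∀ (κ : ZpExtension K 2), κ.IsAnticyclotomic →
    ∀ (γ : absoluteGaloisGroup K) [Fact (κ.IsTopGenerator γ)],
      (W.baseChange K).selmerCorank 2 = 1 →
    ∀ (P : (W.baseChange K).toAffine.Point), IsHeegnerPoint N W K P →
      AcPConverseLinks.CharValueEqLogSqAt W 2 κ vbar γ ι P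

/-! ## §3 The compositions: links ⟹ Heegner non-torsion ⟹ K12₂″ (PROVED) -/

/-- **The c201 leaf `HeegnerNonTorsionCMSevenAdditiveTwo` from the two `2`-adic links** — NO further
input (the leaf is in corank form over `K`, so no descent/Kato step is needed): at the leaf's data
produce the anticyclotomic datum `(κ, γ)`, a degree-one `𝔭 ∋ 2`, THE embedding `ι = embAt K 2 𝔭`,
`v = inducedPlace ι`, `v̄ ≠ v` (b2b CGLS adapter); Link A gives a generator with `F_A(0) ≠ 0`, Link B
a generator with `F_B(0) = u · log²`, `u ≠ 0`; generators of one principal ideal differ by a unit, so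
`log_W(z(m₀ • P_ι)) ≠ 0`, so `P` is not torsion (`AcPConverseLinks.not_isOfFinAddOrder_of_links`).
[cite: CastellaGrossiLeeSkinner2022, §5.2 (proof of Thm. 5.2.1: the shape of a BDP-type p-converse)]
[cite: SilvermanAEC2009, IV.6.4 and VII.2.2] -/
theorem heegnerNonTorsionCMSevenAdditiveTwo_of_twoAdicLinks (hA : TwoAdicControlOfCorankOneCMSeven)
    (hB : TwoAdicCharValueEqHeegnerLogSqCMSeven) : HeegnerNonTorsionCMSevenAdditiveTwo := by
  intro W _ _ _ hj hbad K _ _ hK hHN hH2 _hd8 _hL1 hcK P hP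
  -- the anticyclotomic datum
  obtain ⟨κ, γ, 𝔭, hκ, hγ, h𝔭, he, hf⟩ :=
    X11b.exists_anticyclotomic_generator_degreeOnePrime 2 K hK hH2
  haveI : Fact (κ.IsTopGenerator γ) := ⟨hγ⟩
  let ι : K →+* ℚ_[2] := X11b.embAt K 2 𝔭 h𝔭 he hf
  obtain ⟨vbar, hvbar, hne⟩ :=
    X11b.exists_other_prime hH2 (X11b.inducedPlace ι) (X11b.natCast_mem_inducedPlace ι)
  have hv := X11b.mem_inducedPlace_iff ι
  -- the two links at this datum force `P` to be non-torsion
  exact AcPConverseLinks.not_isOfFinAddOrder_of_links W 2 κ vbar γ ι P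
    (hA W hj hbad K (W.conductorNorm ℤ) rfl hK hHN hH2 ι (X11b.inducedPlace ι) vbar hv hvbar hne κ hκ
      γ hcK)
    (hB W hj hbad K (W.conductorNorm ℤ) rfl hK hHN hH2 ι (X11b.inducedPlace ι) vbar hv hvbar hne κ hκ
      γ hcK P hP)

/-- **Crux K12₂″ (route decl, BY NAME) from the two `2`-adic links and six refereed facts**:
`2`-parity (`hpar`, Dokchitser–Dokchitser), Modularity (`hmod`), Hoffstein–Luo (`hHL`),
Gross–Zagier–Kolyvagin over `ℚ` (`hGZK`, the route's own binder
`rank_eq_analyticRank_of_analyticRank_le_one`), Gross–Zagier over `K` (`hGZ`), `K`-rationality of Heegner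
points (`hHP`, Gross 1984), and the two links `hA`, `hB` — by
`heegnerNonTorsionCMSevenAdditiveTwo_of_twoAdicLinks` and c201's landed chain
`rankOneTwoConverseCMSevenAdditiveTwo_of_heegnerNonTorsion_of_rank_eq_analyticRank` (p420647).
CONDITIONAL on the two open links; credits nothing.
[cite: CastellaGrossiLeeSkinner2022, §5.2 (proof of Thm. 5.2.1)] [cite: GrossZagier1986, Thm. I.(6.3)]
[cite: DokchitserDokchitserAnnals2010, Thm. 1.4 and Cor. 4.20] [cite: HoffsteinLuo1997, Theorem (§1)] -/
theorem rankOneTwoConverseCMSevenAdditiveTwo_of_twoAdicLinks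
    (hpar : ∀ (W : WeierstrassCurve ℚ) [W.IsElliptic], p_parity W 2)
    (hmod : ModularForms.exists_isNewformOf) (hHL : HoffsteinLuo1997_exists_twist_L_one_ne_zero)
    (hGZK : rank_eq_analyticRank_of_analyticRank_le_one)
    (hGZ : ∀ (N : ℕ) [NeZero N] (W : WeierstrassCurve ℚ) (K : Type) [Field K] [NumberField K],
      gross_zagier N W K)
    (hHP : ∀ (W : WeierstrassCurve ℚ) (K : Type) [Field K] [NumberField K], exists_isHeegnerPoint W K)
    (hA : TwoAdicControlOfCorankOneCMSeven) (hB : TwoAdicCharValueEqHeegnerLogSqCMSeven) :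
    Summit.BirchSwinnertonDyer.BirchSwinnertonDyer.Theses.GoldfeldAllTwistsTwoConverse.RankOneTwoConverseCMSevenAdditiveTwo :=
  rankOneTwoConverseCMSevenAdditiveTwo_of_heegnerNonTorsion_of_rank_eq_analyticRank hpar hmod hHL hGZK
    hGZ hHP (heegnerNonTorsionCMSevenAdditiveTwo_of_twoAdicLinks hA hB)

/-- **The same with Kato's finiteness at `2` for the rank-zero twin in place of GZK over `ℚ`**
(c201's other landed chain `rankOneTwoConverseCMSevenAdditiveTwo_of_heegnerNonTorsion`).
CONDITIONAL on the two open links; credits nothing. [cite: Kato2004Asterisque, Cor. 14.3 (p. 235)]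
[cite: CastellaGrossiLeeSkinner2022, §5.2 (proof of Thm. 5.2.1)] -/
theorem rankOneTwoConverseCMSevenAdditiveTwo_of_twoAdicLinks_of_kato
    (hpar : ∀ (W : WeierstrassCurve ℚ) [W.IsElliptic], p_parity W 2)
    (hmod : ModularForms.exists_isNewformOf) (hHL : HoffsteinLuo1997_exists_twist_L_one_ne_zero)
    (hKato : ∀ (W : WeierstrassCurve ℚ) [W.IsElliptic], kato_finite_of_L_one_ne_zero W 2)
    (hGZ : ∀ (N : ℕ) [NeZero N] (W : WeierstrassCurve ℚ) (K : Type) [Field K] [NumberField K],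
      gross_zagier N W K)
    (hHP : ∀ (W : WeierstrassCurve ℚ) (K : Type) [Field K] [NumberField K], exists_isHeegnerPoint W K)
    (hA : TwoAdicControlOfCorankOneCMSeven) (hB : TwoAdicCharValueEqHeegnerLogSqCMSeven) :
    Summit.BirchSwinnertonDyer.BirchSwinnertonDyer.Theses.GoldfeldAllTwistsTwoConverse.RankOneTwoConverseCMSevenAdditiveTwo :=
  rankOneTwoConverseCMSevenAdditiveTwo_of_heegnerNonTorsion hpar hmod hHL hKato hGZ hHP
    (heegnerNonTorsionCMSevenAdditiveTwo_of_twoAdicLinks hA hB)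

/-! ## §4 The RANK form of Link A for the cell, PROVED modulo Poitou–Tate -/

/-- **Link A in RANK form for the additive `ℚ(√−7)`-cell holds, granted Poitou–Tate at the imaginary
quadratic fields**: Link A's binders with the corank hypothesis replaced by `rank W(K) = 1 ∧
#Ш(W/K)[2^∞] < ∞` — instance `p = 2` of `hasCharValuationAt_of_rankOne_of_poitouTate` (`2` splits in
`K` by the Heegner hypothesis for `2`); `hj`, `hbad`, `hN`, `hHN`, `ι`, `v`, `hv`, `hne` are NOT used (the
rank form holds for every globally minimal elliptic `W/ℚ`). CONDITIONAL on `hPT`; credits nothing.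
[cite: MilneADT2006, Ch. I, Thm. 4.10(b) (hypothesis kept)] [cite: JetchevSkinnerWan2017, Prop. 3.2.1 and §3.3] -/
theorem twoAdicControl_rankOne_cmSevenAdditive_of_poitouTate
    (hPT : ∀ (K : Type) [Field K] [NumberField K], IsImaginaryQuadratic K →
      poitouTate_sum_localTatePairing_eq_zero K) :
    ∀ (W : WeierstrassCurve ℚ) [W.IsElliptic] [W.IsGloballyMinimal], W.j = -3375 →
      ¬ W.HasGoodReductionAtPrime 2 →
      ∀ (K : Type) [Field K] [NumberField K] (N : ℕ) [NeZero N],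
      W.conductorNorm ℤ = N → IsImaginaryQuadratic K →
        SatisfiesHeegnerHypothesis N K → SatisfiesHeegnerHypothesis 2 K →
      ∀ (ι : K →+* ℚ_[2]) (v vbar : HeightOneSpectrum (𝓞 K)),
        (∀ x : 𝓞 K, x ∈ v.asIdeal ↔ ‖ι (x : K)‖ < 1) →
        ((2 : ℕ) : 𝓞 K) ∈ vbar.asIdeal → vbar ≠ v →
      ∀ (κ : ZpExtension K 2), κ.IsAnticyclotomic →
      ∀ (γ : absoluteGaloisGroup K) [Fact (κ.IsTopGenerator γ)],
        (W.baseChange K).mordellWeilRank = 1 →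
        Finite (AddCommGroup.primaryComponent (W.baseChange K).sha 2) →
        ∃ m : ℕ, AcSelmer.XAc.HasCharValuationAt (W.baseChange K) 2 κ vbar ∅ γ m := by
  intro W _ _ _hj _hbad K _ _ _N _ _hN hK _hHN hH2 _ι _v vbar _hv hvbar _hne κ hκ γ _ hrank hSha
  exact hasCharValuationAt_of_rankOne_of_poitouTate W 2 (hPT K hK) hK (hH2 2 Fact.out (dvd_refl 2)) κ
    hκ γ vbar hvbar hrank hSha

/-! ## §5 The payoff: the Ш-finite sub-case of K12₂″ from Link B alone (PROVED mod PT + facts) -/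

/-- **Heegner points are non-torsion at a rank-one, Ш-finite datum of the cell, granted Link B and
Poitou–Tate only.** For `W` in the additive `ℚ(√−7)`-cell and `K` imaginary quadratic with the Heegner
hypothesis for `N_W` and for `2`: if `rank W(K) = 1` and `#Ш(W/K)[2^∞] < ∞`, then every Heegner point
`P ∈ W(K)` of level `N_W` has infinite order — corank one by Greenberg's identity, the datum
`(κ, γ, 𝔭, ι, v, v̄)` exists, Link A in rank form by `hasCharValuationAt_of_rankOne_of_poitouTate`, Link B
by `hB`, then `AcPConverseLinks.not_isOfFinAddOrder_of_links`. CONDITIONAL on the OPEN Link B and on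
`hPT` at `K`; credits nothing. [cite: CastellaGrossiLeeSkinner2022, §5.2 (proof of Thm. 5.2.1)]
[cite: SilvermanAEC2009, IV.6.4 and VII.2.2] [cite: MilneADT2006, Ch. I, Thm. 4.10(b) (hypothesis kept)] -/
theorem heegnerPoint_not_isOfFinAddOrder_of_rankOne_of_finiteSha_of_linkB_of_poitouTate
    (hB : TwoAdicCharValueEqHeegnerLogSqCMSeven) (W : WeierstrassCurve ℚ) [W.IsElliptic]
    [W.IsGloballyMinimal] [NeZero (W.conductorNorm ℤ)] (hj : W.j = -3375)
    (hbad : ¬ W.HasGoodReductionAtPrime 2) {K : Type} [Field K] [NumberField K]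
    (hPT : poitouTate_sum_localTatePairing_eq_zero K) (hK : IsImaginaryQuadratic K)
    (hHN : SatisfiesHeegnerHypothesis (W.conductorNorm ℤ) K) (hH2 : SatisfiesHeegnerHypothesis 2 K)
    (hrank : (W.baseChange K).mordellWeilRank = 1)
    (hSha : Finite (AddCommGroup.primaryComponent (W.baseChange K).sha 2))
    (P : (W.baseChange K).toAffine.Point) (hP : IsHeegnerPoint (W.conductorNorm ℤ) W K P) :
    ¬ IsOfFinAddOrder P := by
  haveI : (W.baseChange K).IsElliptic := by rw [baseChange]; infer_instance
  have hcK : (W.baseChange K).selmerCorank 2 = 1 :=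
    selmerCorank_eq_one_of_mordellWeilRank_eq_one_of_finite _ 2 hrank hSha
  -- the anticyclotomic datum
  obtain ⟨κ, γ, 𝔭, hκ, hγ, h𝔭, he, hf⟩ :=
    X11b.exists_anticyclotomic_generator_degreeOnePrime 2 K hK hH2
  haveI : Fact (κ.IsTopGenerator γ) := ⟨hγ⟩
  let ι : K →+* ℚ_[2] := X11b.embAt K 2 𝔭 h𝔭 he hf
  obtain ⟨vbar, hvbar, hne⟩ :=
    X11b.exists_other_prime hH2 (X11b.inducedPlace ι) (X11b.natCast_mem_inducedPlace ι)
  have hv := X11b.mem_inducedPlace_iff ι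
  exact not_isOfFinAddOrder_of_charValueEqLogSqAt_of_rankOne_of_poitouTate W 2 hPT hK
    (hH2 2 Fact.out (dvd_refl 2)) κ hκ γ vbar hvbar ι hrank hSha P
    (hB W hj hbad K (W.conductorNorm ℤ) rfl hK hHN hH2 ι (X11b.inducedPlace ι) vbar hv hvbar hne κ hκ
      γ hcK P hP)

/-- **The Ш-FINITE SUB-CASE of K12₂″ from Link B alone** (plus Poitou–Tate and refereed facts): for every
globally minimal elliptic `W/ℚ` with `j(W) = −3375`, NOT good at `2`, `rank W(ℚ) = 1 ∧ #Ш(W/ℚ)[2^∞] < ∞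
⟹ ord_{s=1} L(W, s) = 1`, granted `2`-parity (`hpar`: corank one ⟹ `w(W) = −1`), Modularity (`hmod`),
Hoffstein–Luo (`hHL`: a `K` with every `ℓ ∣ 2N_W` split and `L(W^{(d_K)},1) ≠ 0`), Kato (`hKato`: descent
of the rank-one data to `K`), Gross 1984 (`hHP`), Gross–Zagier (`hGZ`), Poitou–Tate at imaginary
quadratic fields (`hPT`) and the OPEN Link B (`hB`); then Artin formalism over `K`. The shape of cn100's
crux B for THIS cell, reduced — as there (`cruxB_of_linkB_of_poitouTate`, p432373) — to the analytic link.
CONDITIONAL; credits nothing; BSD is not touched.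
[cite: CastellaGrossiLeeSkinner2022, §5.2 (proof of Thm. 5.2.1)] [cite: GrossZagier1986, Thm. I.(6.3) with V.§2 and I.§7]
[cite: Kato2004Asterisque, Cor. 14.3 (p. 235)] [cite: DokchitserDokchitserAnnals2010, Thm. 1.4 and Cor. 4.20]
[cite: HoffsteinLuo1997, Theorem (§1, pp. 435–436)] [cite: MilneADT2006, Ch. I, Thm. 4.10(b) (hypothesis kept)] -/
theorem analyticRank_eq_one_of_rankOne_of_finiteSha_of_linkB_of_poitouTate
    (hpar : ∀ (W : WeierstrassCurve ℚ) [W.IsElliptic], p_parity W 2)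
    (hmod : ModularForms.exists_isNewformOf) (hHL : HoffsteinLuo1997_exists_twist_L_one_ne_zero)
    (hKato : ∀ (W : WeierstrassCurve ℚ) [W.IsElliptic] (p : ℕ) [Fact p.Prime],
      kato_finite_of_L_one_ne_zero W p)
    (hHP : ∀ (W : WeierstrassCurve ℚ) (K : Type) [Field K] [NumberField K], exists_isHeegnerPoint W K)
    (hGZ : ∀ (N : ℕ) [NeZero N] (W : WeierstrassCurve ℚ) (K : Type) [Field K] [NumberField K],
      gross_zagier N W K)
    (hPT : ∀ (K : Type) [Field K] [NumberField K], IsImaginaryQuadratic K →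
      poitouTate_sum_localTatePairing_eq_zero K)
    (hB : TwoAdicCharValueEqHeegnerLogSqCMSeven)
    (W : WeierstrassCurve ℚ) [W.IsElliptic] [W.IsGloballyMinimal] (hj : W.j = -3375)
    (hbad : ¬ W.HasGoodReductionAtPrime 2) (hrank : W.mordellWeilRank = 1)
    (hSha : Finite (AddCommGroup.primaryComponent W.sha 2)) : W.analyticRank = 1 := by
  haveI : NeZero (W.conductorNorm ℤ) := ⟨(W.conductorNorm_pos_holds).ne'⟩
  -- corank one over `ℚ`, hence sign `−1` by `2`-parity
  have hcorank : W.selmerCorank 2 = 1 :=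
    selmerCorank_eq_one_of_mordellWeilRank_eq_one_of_finite W 2 hrank hSha
  have hw : W.rootNumber = -1 := by
    have h := hpar W
    unfold p_parity at h
    rw [hcorank, pow_one] at h
    exact h.symm
  -- the auxiliary Heegner field with `2` split and `L(W^{(d_K)}, 1) ≠ 0`
  obtain ⟨K, _, _, hK, -, hHN, hH2, -, hL1⟩ :=
    exists_heegnerField_split_twist_ne_zero_discr_emod_eight_of_hoffsteinLuo hmod hHL W hw
      Nat.prime_two 0
  -- descent of the rank-one data to `K` (Kato on the twist)
  obtain ⟨hrkK, -, hShaK⟩ :=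
    AcPConverseLinks.rank_corank_sha_baseChange_of_twist_L_one_ne_zero hKato W 2 hK hL1 hrank hSha
  -- a Heegner point, non-torsion by Link B and Poitou–Tate
  obtain ⟨P, hP⟩ := hHP W K hK hHN
  have hnt : ¬ IsOfFinAddOrder P :=
    heegnerPoint_not_isOfFinAddOrder_of_rankOne_of_finiteSha_of_linkB_of_poitouTate hB W hj hbad
      (hPT K hK) hK hHN hH2 hrkK hShaK P hP
  -- Gross–Zagier: `ord_{s=1} L(W/K, s) = 1`
  have hEK : analyticRankEK W K = 1 :=
    (analyticRankEK_eq_one_iff_heegner_nonTorsion_of_exists_isNewformOf W (W.conductorNorm ℤ) K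
      (hGZ _ W K) hmod hK rfl hHN hP).mpr hnt
  -- Artin formalism over `K`
  rw [analyticRankEK_eq_add_of (hasEntireLFunction_rat_of_exists_isNewformOf hmod) W K,
    analyticRank_eq_zero_of_entireLFunction_one_ne_zero _ hL1, add_zero] at hEK
  exact hEK

end Summit.BirchSwinnertonDyer.BirchSwinnertonDyer.Theorems.GoldfeldGoodTwists

end
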